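import Literature.AnabelianGeometry.EtaleTheta.ThetaSubquotientOfTemperedAut
import Literature.AnabelianGeometry.EtaleTheta.ThetaSubquotientOfTemperedGalois

/-!
# [EtTh] §5: the theta subquotients `(l·Δ_Θ)_E` — CHANGE OF COEFFICIENTS `(q, ι) → (q′, ι′)` and corestriction

Mochizuki, *The étale theta function and its Frobenioid-theoretic manifestations*, Publ. RIMS **45** (2009), §5 p. 327 (PDF
p. 101) [cite: MochizukiEtTh2009, §5 p.327 (PDF p.101)]: "`(Π^tp_X)^Θ ⊇ l·Δ_Θ` … these subquotients determine subquotients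
`Aut_D(D) ↠ Aut^Θ_D(D)`; `(l·Δ_Θ)_D ⊆ Aut^Θ_D(D)`"; Def. 5.4 (b) / Prop. 5.5 p. 327 (PDF p. 101): everything downstream reads
"`(l·Δ_Θ)_S ⊗ ℤ/Nℤ`", i.e. the subquotients with coefficients reduced along `l·Δ_Θ ↠ (l·Δ_Θ) ⊗ ℤ/Nℤ ≅ μ_N` (Prop. 2.12 (i), p. 271).
abc-iut cell, layer L2, seat abc-iut-L2-t9 (gen 3; unit W2-L2-05 lineage, author of the R2 instance `thetaSubquotientStub q ι`),
row «CHANGE OF COEFFICIENTS for the theta subquotients (thetaMod-vs-evalEquiv)».  CONSTRUCTION file (DEFS-FREEZE class (b)): the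
canonical homomorphisms between two instances of the R2 carrier; nothing landed is edited or restated; no instance, no notation,
no `Prop`-valued definition.

WHY.  Two instances of abc-iut-L2-t9's `thetaSubquotientStub` now live over the genuine base `B^temp(Π^tp_X̲̲)⁰`: print's own pair
`(q, ι) = ((Π^tp_X ↠ (Π^tp_X)^Θ)|_{Π^tp_X̲̲}, l·Δ_Θ ↪ (Π^tp_X)^Θ)` (`ThetaSubquotientOfThetaSetting.lean`, pinned into abc-iut-L2-t4's
`ofThetaSettingDataQ`) and abc-iut-w4-d042's LEVEL-`N` pair `(q_N, ι_N) = (Π ↠ Π/K_N, μ_N ↪ Π/K_N)` (`ThetaSubquotientLevelN.lean`,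
`RigidData.levelStub`, at which Prop. 5.5's binders are theorems).  The second is the first with coefficients reduced along
`thetaMod : l·Δ_Θ ↠ μ_N`; the comparison ("thetaMod-vs-evalEquiv", a residual NAMED INPUT of plan/L2 SUBDAG-EtTh-Thm56 v3.1) is an
instance of the functoriality of the carrier IN THE COEFFICIENT PAIR, which this file supplies in general.

WHAT IS CONSTRUCTED / PROVED.  A morphism of coefficient pairs `(q : Π → Q, ι : Λ → Q) → (q′ : Π → Q′, ι′ : Λ′ → Q′)` is
`(φ : Q → Q′, ψ : Λ → Λ′)` with `φ ∘ q = q′`, `φ ∘ ι = ι′ ∘ ψ` (`L`, `L′` normal).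
* `killQ_map_le` — `φ(J(S)) ⊆ J′(S)`; `kill_le_comap` — `ι⁻¹J(S) ⊆ ψ⁻¹ι′⁻¹J′(S)`; `carrierMap` — the induced `Λ/J(S) → Λ′/J′(S)`;
* `comp_mem_fam` / `comp_mem_null` — `ψ ∘ t` is a compatible (resp. null) family when `t` is;
* **`coeffMap : (l·Δ_Θ)_E(q, ι) →* (l·Δ_Θ)_E(q′, ι′)`**, `[t] ↦ [ψ ∘ t]` (`coeffMap_mk`), with
  **`evalAt_coeffMap`** — evaluation at a point intertwines `coeffMap` with `carrierMap` (THE "thetaMod-vs-evalEquiv" square: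
  `evalAt′_x ∘ coeffMap = carrierMap ∘ evalAt_x`), **`map_coeffMap`** — `coeffMap` commutes with the transports `lDeltaMap` along every
  morphism `f : E → E′` of connected objects (so `coeffMap` is a morphism of `ThetaSubquotientStub`s), `coeffMap_comp` / `coeffMap_id`;
* **`autPre_le_autPre`** — print's `Aut`-subquotient domain grows along `(φ, ψ)` (`autPre q ι E ≤ autPre q′ ι′ E`) and
  **`coeffMap_autProj`** — `coeffMap ∘ autProj = autProj′ ∘ incl` at connected objects: the `Aut`-projection is compatible;
* CORESTRICTION (`φ` need only be defined where the carrier lives): for a subgroup `Q₀ ≤ Q` containing `q(Π)` and `ι(Λ)`, the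
  corestricted pair `(q₀, ι₀) := (q.codRestrict Q₀, ι.codRestrict Q₀)` has `killQ q ι S = Q₀.subtype (killQ q₀ ι₀ S)`
  (`map_subtype_killQ_codRestrict`), the SAME compatible / null families (`fam_codRestrict_eq`, `null_codRestrict_eq`) and hence
  **`coeffEquivOfCodRestrict : (l·Δ_Θ)_E(q₀, ι₀) ≃* (l·Δ_Θ)_E(q, ι)`** (the `coeffMap` along `(Q₀.subtype, id)`, bijective) — so a change
  of coefficients defined only on `q(Π)·L ⊆ Q` (the double underline situation: `(Π^tp_X̲̲)^Θ ⊊ (Π^tp_X)^Θ`) is handled by corestricting first;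
  `autPre_codRestrict_eq` / `coeffEquivOfCodRestrict_autProj` (v2) — corestriction changes neither print's `Aut`-subquotient domain nor,
  through the isomorphism, its projection.

HONEST FRAMING: generic group/temperoid-theoretic facts about abc-iut-L2-t9's carriers; all of `Π, q, ι, q′, ι′, φ, ψ` are parameters;
nothing is asserted about [EtTh]'s curves; [EtTh] is refereed and nothing here bears on [IUTchIII] Cor. 3.12 — no side is taken;
typed ≠ proved.
-/

noncomputable section

namespace Literature.AnabelianGeometry.EtaleTheta

namespace ThetaSubquotient

open CategoryTheory Literature.AlgebraicGeometry.Frobenioids Literature.AnabelianGeometry.SemiGraphs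
open Literature.AlgebraicGeometry.Frobenioids.QuasiTemperoid (stabilizerSubgroup)
open Literature.AlgebraicGeometry.Frobenioids.QuasiTemperoid.BTempConnected (hom_ρ ρ_mul_apply exists_ρ_eq_of_isConnectedObj)

universe u v w v' w'

variable {G : Type u} [Group G]
  {Q : Type v} [Group Q] {Λ : Type w} [CommGroup Λ] (q : G →* Q) (ι : Λ →* Q)
  {Q' : Type v'} [Group Q'] {Λ' : Type w'} [CommGroup Λ'] (q' : G →* Q') (ι' : Λ' →* Q')
  (φ : Q →* Q') (ψ : Λ →* Λ') (hq : φ.comp q = q') (hι : φ.comp ι = ι'.comp ψ)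

/-! ### 1. The killed subgroups and the carriers along `(φ, ψ)` -/

section Kill

include hq hι in
/-- `φ(J(S)) ⊆ J′(S)`: `φ` carries `q(S)` into `q′(S)`, `L` into `L′`, and commutators to commutators.
[cite: MochizukiEtTh2009, §5 p.327 (PDF p.101)] -/
theorem killQ_map_le (S : Subgroup G) : (killQ q ι S).map φ ≤ killQ q' ι' S := by
  have hS : (S.map q).map φ ≤ S.map q' := by
    rw [Subgroup.map_map, hq]
  have hL : ι.range.map φ ≤ ι'.range := by
    rw [MonoidHom.map_range, hι, ← MonoidHom.map_range]
    exact Subgroup.map_le_range _ _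
  unfold killQ
  rw [Subgroup.map_sup]
  refine sup_le_sup ?_ ?_
  · exact (Subgroup.map_inf_le _ _ _).trans (inf_le_inf hS hL)
  · rw [Subgroup.map_commutator]
    exact Subgroup.commutator_mono hL hS

include hq hι in
/-- `ι⁻¹J(S) ⊆ ψ⁻¹ ι′⁻¹ J′(S)`. [cite: MochizukiEtTh2009, §5 p.327 (PDF p.101)] -/
theorem kill_le_comap (S : Subgroup G) : kill q ι S ≤ (kill q' ι' S).comap ψ := by
  intro a ha
  rw [Subgroup.mem_comap, Subgroup.mem_comap]
  have h1 : ι' (ψ a) = φ (ι a) := by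
    rw [← MonoidHom.comp_apply, ← hι, MonoidHom.comp_apply]
  rw [h1]
  exact killQ_map_le q ι q' ι' φ ψ hq hι S ⟨ι a, ha, rfl⟩

/-- **The induced map of carriers `Λ/J(S) → Λ′/J′(S)`** at a stabiliser `S`, `[a] ↦ [ψ a]`.
[cite: MochizukiEtTh2009, §5 p.327 (PDF p.101)] -/
def carrierMap (S : Subgroup G) : Carrier q ι S →* Carrier q' ι' S :=
  QuotientGroup.map _ _ ψ (kill_le_comap q ι q' ι' φ ψ hq hι S)

/-- `carrierMap` on classes. [cite: MochizukiEtTh2009, §5 p.327 (PDF p.101)] -/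
@[simp] theorem carrierMap_mk (S : Subgroup G) (a : Λ) :
    carrierMap q ι q' ι' φ ψ hq hι S (QuotientGroup.mk a) = QuotientGroup.mk (ψ a) := rfl

end Kill

/-! ### 2. Families along `(φ, ψ)` and the homomorphism `coeffMap` -/

section Coeff

variable [TopologicalSpace G] (E : BTemp G)

include hq hι in
/-- Null families stay null after composing with `ψ`. [cite: MochizukiEtTh2009, §5 p.327 (PDF p.101)] -/
theorem comp_mem_null {t : E.obj.V → Λ} (ht : t ∈ Null q ι E) : ψ ∘ t ∈ Null q' ι' E := by
  intro x
  exact kill_le_comap q ι q' ι' φ ψ hq hι _ (ht x)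

variable [ι.range.Normal] [ι'.range.Normal]

include hq hι in
/-- Compatible families stay compatible after composing with `ψ`: apply `φ` to the defining element
`ι(t_{g·x})⁻¹ · q(g) ι(t_x) q(g)⁻¹ ∈ J(Stab(g·x))`. [cite: MochizukiEtTh2009, §5 p.327 (PDF p.101)] -/
theorem comp_mem_fam {t : E.obj.V → Λ} (ht : t ∈ Fam q ι E) : ψ ∘ t ∈ Fam q' ι' E := by
  intro g x
  have h := killQ_map_le q ι q' ι' φ ψ hq hι _ ⟨_, ht g x, rfl⟩
  simp only [map_mul, map_inv] at h
  have e1 : ∀ a, ι' (ψ a) = φ (ι a) := fun a => by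
    rw [← MonoidHom.comp_apply, ← hι, MonoidHom.comp_apply]
  have e2 : q' g = φ (q g) := by rw [← MonoidHom.comp_apply, hq]
  simpa only [Function.comp_apply, e1, e2] using h

/-- Composition with `ψ` on compatible families. [cite: MochizukiEtTh2009, §5 p.327 (PDF p.101)] -/
def famCoeff : Fam q ι E →* Fam q' ι' E :=
  ((MonoidHom.compLeft ψ E.obj.V).comp (Fam q ι E).subtype).codRestrict (Fam q' ι' E) fun t =>
    comp_mem_fam q ι q' ι' φ ψ hq hι E t.2

/-- `famCoeff` on functions: `(famCoeff t) x = ψ (t x)`. [cite: MochizukiEtTh2009, §5 p.327 (PDF p.101)] -/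
@[simp] theorem coe_famCoeff (t : Fam q ι E) (x : E.obj.V) :
    (famCoeff q ι q' ι' φ ψ hq hι E t : E.obj.V → Λ') x = ψ ((t : E.obj.V → Λ) x) := rfl

/-- **Change of coefficients `(l·Δ_Θ)_E(q, ι) → (l·Δ_Θ)_E(q′, ι′)`**, `[t] ↦ [ψ ∘ t]`.
[cite: MochizukiEtTh2009, §5 p.327 (PDF p.101)] -/
def coeffMap : LDelta q ι E →* LDelta q' ι' E :=
  QuotientGroup.map _ _ (famCoeff q ι q' ι' φ ψ hq hι E) fun t ht => by
    rw [Subgroup.mem_comap, Subgroup.mem_subgroupOf]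
    exact comp_mem_null q ι q' ι' φ ψ hq hι E (Subgroup.mem_subgroupOf.mp ht)

/-- `coeffMap` on classes. [cite: MochizukiEtTh2009, §5 p.327 (PDF p.101)] -/
@[simp] theorem coeffMap_mk (t : Fam q ι E) :
    coeffMap q ι q' ι' φ ψ hq hι E (mk q ι E t) = mk q' ι' E (famCoeff q ι q' ι' φ ψ hq hι E t) := rfl

/-- **"thetaMod-vs-evalEquiv"**: evaluation at a point intertwines the change of coefficients with the induced map of carriers,
`evalAt′_x ∘ coeffMap = carrierMap ∘ evalAt_x`. [cite: MochizukiEtTh2009, §5 p.327 (PDF p.101)] -/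
theorem evalAt_coeffMap (x : E.obj.V) (c : LDelta q ι E) :
    evalAt q' ι' E x (coeffMap q ι q' ι' φ ψ hq hι E c) =
      carrierMap q ι q' ι' φ ψ hq hι (stabilizerSubgroup E x) (evalAt q ι E x c) := by
  induction c using QuotientGroup.induction_on with
  | H t => rfl

/-- With the evaluation ISOMORPHISMS at a connected object (abc-iut-L2-t9's `evalEquiv`): `coeffMap` IS `carrierMap` read through them.
[cite: MochizukiEtTh2009, §5 p.327 (PDF p.101)] -/
theorem coeffMap_eq_evalEquiv_conj (hE : IsConnectedObj E) (x : E.obj.V) (c : LDelta q ι E) :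
    coeffMap q ι q' ι' φ ψ hq hι E c =
      (evalEquiv q' ι' hE x).symm (carrierMap q ι q' ι' φ ψ hq hι (stabilizerSubgroup E x) (evalEquiv q ι hE x c)) := by
  apply (evalEquiv q' ι' hE x).injective
  rw [MulEquiv.apply_symm_apply, evalEquiv_apply, evalEquiv_apply, evalAt_coeffMap]

end Coeff

/-! ### 3. Naturality with respect to the transports along morphisms of connected objects -/

section Natural

variable [TopologicalSpace G] [ι.range.Normal] [ι'.range.Normal] {E E' : BTemp G} (hE : IsConnectedObj E) (hE' : IsConnectedObj E')
  (f : E ⟶ E')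

/-- **`coeffMap` commutes with the push-forwards `lDeltaMap`** (both evaluate families at the same chosen preimages):
`coeffMap_{E′} ∘ map_f = map_f ∘ coeffMap_E` — `coeffMap` is a morphism of abc-iut-L2-t4's `ThetaSubquotientStub` data.
[cite: MochizukiEtTh2009, §5 p.327 (PDF p.101)] -/
theorem map_coeffMap (c : LDelta q ι E) :
    map q' ι' hE hE' f (coeffMap q ι q' ι' φ ψ hq hι E c) = coeffMap q ι q' ι' φ ψ hq hι E' (map q ι hE hE' f c) := by
  induction c using QuotientGroup.induction_on with
  | H t => rfl

end Natural

/-! ### 4. Functoriality of `coeffMap` in `(φ, ψ)` -/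

section Functorial

variable [TopologicalSpace G] (E : BTemp G) [ι.range.Normal] [ι'.range.Normal]
  {Q'' : Type v} [Group Q''] {Λ'' : Type w} [CommGroup Λ''] (q'' : G →* Q'') (ι'' : Λ'' →* Q'') [ι''.range.Normal]
  (φ' : Q' →* Q'') (ψ' : Λ' →* Λ'') (hq' : φ'.comp q' = q'') (hι' : φ'.comp ι' = ι''.comp ψ')

/-- `coeffMap` along the identity is the identity. [cite: MochizukiEtTh2009, §5 p.327 (PDF p.101)] -/
theorem coeffMap_id (c : LDelta q ι E) :
    coeffMap q ι q ι (MonoidHom.id Q) (MonoidHom.id Λ) (MonoidHom.id_comp q) (by rw [MonoidHom.id_comp, MonoidHom.comp_id]) E c =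
      c := by
  induction c using QuotientGroup.induction_on with
  | H t => rfl

/-- `coeffMap` along a composite is the composite. [cite: MochizukiEtTh2009, §5 p.327 (PDF p.101)] -/
theorem coeffMap_comp (c : LDelta q ι E) :
    coeffMap q' ι' q'' ι'' φ' ψ' hq' hι' E (coeffMap q ι q' ι' φ ψ hq hι E c) =
      coeffMap q ι q'' ι'' (φ'.comp φ) (ψ'.comp ψ) (by rw [MonoidHom.comp_assoc, hq, hq'])
        (by rw [MonoidHom.comp_assoc, hι, ← MonoidHom.comp_assoc, hι', MonoidHom.comp_assoc]) E c := by
  induction c using QuotientGroup.induction_on with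
  | H t => rfl

end Functorial

/-! ### 5. Compatibility with print's `Aut`-subquotient `autPre ↠ (l·Δ_Θ)_E` -/

section AutCompat

variable [TopologicalSpace G] (E : BTemp G)

include hq hι in
/-- **`autPre` grows along `(φ, ψ)`**: an automorphism acting at every point as some `n` with `q(n) ∈ L` acts as `n` with
`q′(n) = φ(q n) ∈ φ(L) ⊆ L′`. [cite: MochizukiEtTh2009, §5 p.327 (PDF p.101)] -/
theorem autPre_le_autPre : autPre q ι E ≤ autPre q' ι' E := by
  intro σ hσ x
  obtain ⟨n, ⟨a, ha⟩, hx⟩ := hσ x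
  refine ⟨n, ⟨ψ a, ?_⟩, hx⟩
  rw [← MonoidHom.comp_apply, ← hι, MonoidHom.comp_apply, ha, ← MonoidHom.comp_apply, hq]

variable [ι.range.Normal] [ι'.range.Normal]

/-- **The `Aut`-projections are compatible with the change of coefficients** at a connected object:
`coeffMap (autProj σ) = autProj′ σ` for `σ ∈ autPre(q, ι) ⊆ autPre(q′, ι′)` (both evaluate at `x` to the class determined by ANY
`n` carrying `x` to `σ x` — abc-iut-L2-t9's `evalAt_autProj` — and evaluation is injective on connected objects).
[cite: MochizukiEtTh2009, §5 p.327 (PDF p.101)] -/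
theorem coeffMap_autProj (hE : IsConnectedObj E) (σ : autPre q ι E) :
    coeffMap q ι q' ι' φ ψ hq hι E (autProj q ι E σ) =
      autProj q' ι' E ⟨σ, autPre_le_autPre q ι q' ι' φ ψ hq hι E σ.2⟩ := by
  obtain ⟨x⟩ := QuasiTemperoid.BTempConnected.nonempty_of_isConnectedObj E hE
  apply evalAt_injective q' ι' hE x
  obtain ⟨n, ⟨a, ha⟩, hx⟩ := σ.2 x
  have ha' : ι' (ψ a) = q' n := by
    rw [← MonoidHom.comp_apply, ← hι, MonoidHom.comp_apply, ha, ← MonoidHom.comp_apply, hq]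
  rw [evalAt_coeffMap, evalAt_autProj q ι E σ x n a ha hx, carrierMap_mk,
    evalAt_autProj q' ι' E _ x n (ψ a) ha' hx]

end AutCompat

/-! ### 6. Corestriction to a subgroup `Q₀ ≤ Q` containing `q(Π)` and `L` -/

section Corestrict

variable (Q₀ : Subgroup Q) (hq₀ : ∀ g, q g ∈ Q₀) (hι₀ : ∀ a, ι a ∈ Q₀)

/-- `q₀ : Π → Q₀`, the corestriction of `q`. [cite: MochizukiEtTh2009, §5 p.327 (PDF p.101)] -/
abbrev qRes : G →* Q₀ := q.codRestrict Q₀ hq₀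

/-- `ι₀ : Λ → Q₀`, the corestriction of `ι`. [cite: MochizukiEtTh2009, §5 p.327 (PDF p.101)] -/
abbrev ιRes : Λ →* Q₀ := ι.codRestrict Q₀ hι₀

/-- `Q₀.subtype ∘ q₀ = q`. [cite: MochizukiEtTh2009, §5 p.327 (PDF p.101)] -/
theorem subtype_comp_qRes : Q₀.subtype.comp (qRes q Q₀ hq₀) = q := MonoidHom.ext fun _ => rfl

/-- `Q₀.subtype ∘ ι₀ = ι = ι ∘ id`. [cite: MochizukiEtTh2009, §5 p.327 (PDF p.101)] -/
theorem subtype_comp_ιRes : Q₀.subtype.comp (ιRes ι Q₀ hι₀) = ι.comp (MonoidHom.id Λ) := MonoidHom.ext fun _ => rfl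

/-- `L₀ = ι₀(Λ)` is normal in `Q₀` (as `L` is normal in `Q`). [cite: MochizukiEtTh2009, §5 p.327 (PDF p.101)] -/
theorem range_ιRes_normal [h : ι.range.Normal] : (ιRes ι Q₀ hι₀).range.Normal := by
  refine ⟨fun a ha c => ?_⟩
  obtain ⟨b, rfl⟩ := ha
  obtain ⟨b', hb'⟩ := h.conj_mem (ι b) ⟨b, rfl⟩ (c : Q)
  exact ⟨b', Subtype.ext (by simpa using hb')⟩

/-- **`J(S) = Q₀.subtype(J₀(S))`**: the killed subgroup of `(q, ι)` is the image of that of the corestricted pair (`Q₀.subtype` is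
injective, so images commute with `⊓`, `⊔` and commutators). [cite: MochizukiEtTh2009, §5 p.327 (PDF p.101)] -/
theorem map_subtype_killQ_codRestrict (S : Subgroup G) :
    (killQ (qRes q Q₀ hq₀) (ιRes ι Q₀ hι₀) S).map Q₀.subtype = killQ q ι S := by
  have hS : (S.map (qRes q Q₀ hq₀)).map Q₀.subtype = S.map q := by
    rw [Subgroup.map_map, subtype_comp_qRes]
  have hL : (ιRes ι Q₀ hι₀).range.map Q₀.subtype = ι.range := by
    rw [MonoidHom.map_range, subtype_comp_ιRes, MonoidHom.comp_id]
  unfold killQ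
  rw [Subgroup.map_sup, Subgroup.map_inf_eq _ _ _ Q₀.subtype_injective, Subgroup.map_commutator, hS, hL]

/-- Hence `ι₀⁻¹J₀(S) = ι⁻¹J(S)` in `Λ`. [cite: MochizukiEtTh2009, §5 p.327 (PDF p.101)] -/
theorem kill_codRestrict_eq (S : Subgroup G) : kill (qRes q Q₀ hq₀) (ιRes ι Q₀ hι₀) S = kill q ι S := by
  ext a
  rw [Subgroup.mem_comap, Subgroup.mem_comap, ← map_subtype_killQ_codRestrict q ι Q₀ hq₀ hι₀ S]
  constructor
  · intro h; exact ⟨_, h, rfl⟩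
  · rintro ⟨y, hy, hya⟩
    have : y = ιRes ι Q₀ hι₀ a := Q₀.subtype_injective hya
    rwa [this] at hy

variable [TopologicalSpace G]

/-- The null families of the two pairs coincide. [cite: MochizukiEtTh2009, §5 p.327 (PDF p.101)] -/
theorem null_codRestrict_eq (E : BTemp G) : Null (qRes q Q₀ hq₀) (ιRes ι Q₀ hι₀) E = Null q ι E := by
  ext t
  simp only [mem_null_iff]
  refine forall_congr' fun x => ?_
  rw [← Subgroup.mem_comap, ← Subgroup.mem_comap]
  change t x ∈ kill _ _ _ ↔ t x ∈ kill _ _ _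
  rw [kill_codRestrict_eq]

variable [ι.range.Normal]

/-- The compatible families of the two pairs coincide. [cite: MochizukiEtTh2009, §5 p.327 (PDF p.101)] -/
theorem fam_codRestrict_eq (E : BTemp G) :
    haveI := range_ιRes_normal ι Q₀ hι₀
    Fam (qRes q Q₀ hq₀) (ιRes ι Q₀ hι₀) E = Fam q ι E := by
  ext t
  simp only [mem_fam_iff]
  refine forall_congr' fun g => forall_congr' fun x => ?_
  rw [← map_subtype_killQ_codRestrict q ι Q₀ hq₀ hι₀]
  constructor
  · intro h
    exact ⟨_, h, by simp [map_mul, map_inv]⟩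
  · rintro ⟨y, hy, hya⟩
    have : y = ((ιRes ι Q₀ hι₀) (t (E.obj.ρ g x)))⁻¹ *
        ((qRes q Q₀ hq₀) g * (ιRes ι Q₀ hι₀) (t x) * ((qRes q Q₀ hq₀) g)⁻¹) :=
      Q₀.subtype_injective (by simpa [map_mul, map_inv] using hya)
    rwa [this] at hy

/-- **Corestriction changes nothing: `(l·Δ_Θ)_E(q₀, ι₀) ≃* (l·Δ_Θ)_E(q, ι)`** — the change of coefficients along `(Q₀ ↪ Q, id)`,
which is bijective (same families, same null families). [cite: MochizukiEtTh2009, §5 p.327 (PDF p.101)] -/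
def coeffEquivOfCodRestrict (E : BTemp G) :
    haveI := range_ιRes_normal ι Q₀ hι₀
    LDelta (qRes q Q₀ hq₀) (ιRes ι Q₀ hι₀) E ≃* LDelta q ι E :=
  haveI := range_ιRes_normal ι Q₀ hι₀
  MulEquiv.ofBijective
    (coeffMap (qRes q Q₀ hq₀) (ιRes ι Q₀ hι₀) q ι Q₀.subtype (MonoidHom.id Λ) (subtype_comp_qRes q Q₀ hq₀)
      (subtype_comp_ιRes ι Q₀ hι₀) E)
    (by
      constructor
      · rw [← MonoidHom.ker_eq_bot_iff, eq_bot_iff]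
        intro c hc
        induction c using QuotientGroup.induction_on with
        | H t =>
          rw [MonoidHom.mem_ker, coeffMap_mk, QuotientGroup.eq_one_iff, Subgroup.mem_subgroupOf] at hc
          have hc' : ((t : E.obj.V → Λ)) ∈ Null q ι E := hc
          rw [Subgroup.mem_bot, QuotientGroup.eq_one_iff, Subgroup.mem_subgroupOf, null_codRestrict_eq]
          exact hc'
      · intro c
        induction c using QuotientGroup.induction_on with
        | H t =>
          refine ⟨mk _ _ E ⟨(t : E.obj.V → Λ), ?_⟩, rfl⟩
          rw [fam_codRestrict_eq]; exact t.2)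

/-- `coeffEquivOfCodRestrict` on classes: the same underlying family. [cite: MochizukiEtTh2009, §5 p.327 (PDF p.101)] -/
theorem coeffEquivOfCodRestrict_mk (E : BTemp G)
    (t : haveI := range_ιRes_normal ι Q₀ hι₀; Fam (qRes q Q₀ hq₀) (ιRes ι Q₀ hι₀) E) :
    haveI := range_ιRes_normal ι Q₀ hι₀
    coeffEquivOfCodRestrict q ι Q₀ hq₀ hι₀ E (mk _ _ E t) =
      mk q ι E ⟨(t : E.obj.V → Λ), (fam_codRestrict_eq q ι Q₀ hq₀ hι₀ E) ▸ t.2⟩ := rfl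

omit [ι.range.Normal] in
/-- **Corestriction does not change print's `Aut`-subquotient domain**: `autPre(q₀, ι₀) E = autPre(q, ι) E` (the condition
`q(n) ∈ ι(Λ)` is read inside `Q₀` or inside `Q` alike). [cite: MochizukiEtTh2009, §5 p.327 (PDF p.101)] -/
theorem autPre_codRestrict_eq (E : BTemp G) : autPre (qRes q Q₀ hq₀) (ιRes ι Q₀ hι₀) E = autPre q ι E := by
  refine le_antisymm ?_ ?_
  · exact autPre_le_autPre (qRes q Q₀ hq₀) (ιRes ι Q₀ hι₀) q ι Q₀.subtype (MonoidHom.id Λ)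
      (subtype_comp_qRes q Q₀ hq₀) (subtype_comp_ιRes ι Q₀ hι₀) E
  · intro σ hσ x
    obtain ⟨n, ⟨a, ha⟩, hx⟩ := hσ x
    exact ⟨n, ⟨a, Subtype.ext ha⟩, hx⟩

/-- With the corestriction isomorphism the `Aut`-projections correspond: `coeffEquivOfCodRestrict (autProj₀ σ) = autProj σ` at a
connected object (an instance of `coeffMap_autProj`). [cite: MochizukiEtTh2009, §5 p.327 (PDF p.101)] -/
theorem coeffEquivOfCodRestrict_autProj (E : BTemp G) (hE : IsConnectedObj E)
    (σ : haveI := range_ιRes_normal ι Q₀ hι₀; autPre (qRes q Q₀ hq₀) (ιRes ι Q₀ hι₀) E) :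
    haveI := range_ιRes_normal ι Q₀ hι₀
    coeffEquivOfCodRestrict q ι Q₀ hq₀ hι₀ E (autProj (qRes q Q₀ hq₀) (ιRes ι Q₀ hι₀) E σ) =
      autProj q ι E ⟨σ, (autPre_codRestrict_eq q ι Q₀ hq₀ hι₀ E) ▸ σ.2⟩ :=
  haveI := range_ιRes_normal ι Q₀ hι₀
  coeffMap_autProj (qRes q Q₀ hq₀) (ιRes ι Q₀ hι₀) q ι Q₀.subtype (MonoidHom.id Λ) (subtype_comp_qRes q Q₀ hq₀)
    (subtype_comp_ιRes ι Q₀ hι₀) E hE σ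

end Corestrict

end ThetaSubquotient

end Literature.AnabelianGeometry.EtaleTheta

end
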